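import Summits.ValiantsHypothesis.ValiantsHypothesis.Theorems.BarrierLeverDefinableEquationsUnipotentNormalForm

/-!
# Crux `BarrierLever.DefinableEquations` (stmt-ValiantsHypothesis-8745) / `SingleSizeEquations`
# (8749) — NORMAL FORM: the witness may be taken to be a HIGHEST WEIGHT VECTOR

Final file of the normal-form programme (design memo `HWV-NORMAL-FORM-PLAN.md`, evidence #9 on
stmt-ValiantsHypothesis-8749).  It combines the two halves in the tree:

* TORUS (`…Isobaric/WeightVector.lean`, g5): the witness may be taken a torus weight vector;
* BOREL (`…UnipotentNormalForm.lean`, this seat): the witness may be taken invariant under the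
  unipotent radical `U_n` (all `x_j ↦ x_j + Σ_{i<j} t_ij x_i`);

into ONE (`definableEquations_iff_highestWeightVector`, `singleSizeEquations_iff_highestWeightVector`;
pointwise `hwvEq_of_eq : Eq(n, b+5, a) → HWVEq(n, b, a+7)`): the crux holds iff for ONE level `a`
and EVERY `b`, eventually in `n`, some nonzero level-`a` Boolean-sum equation against
`SmallCircuits ℂ n b` is a torus weight vector of weight `(d; w)` AND is `U_n`-invariant — a
HIGHEST WEIGHT VECTOR of the `GL_n`-module of polynomial functions on `Sym^{≤n}(ℂ^n)`, i.e. exactly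
the shape in which geometric complexity theory writes obstructions ("an explicit HWV of weight `λ`
in the ideal of the orbit closure"), here with VNP(N)-explicitness built in.

ORDER OF EXTRACTION.  First `U` (`uEq_of_eq`), then the torus (`isoUEq_of_uEq`): the torus
NORMALISES `U`, so a torus-type isobaric component of a `U`-invariant polynomial is `U`-invariant
(`eval_uAct_component`, from the equivariance `τ • (T_t c) = T_{t'}(τ • c)`,
`t'_ij = t_ij τ^{u_i} τ^{-u_j}`, `torus_uAct`, and coefficient extraction in `τ`); the converse order
would fail (the `S_n`-sorting of `…DominantWeight.lean` does not normalise `U`, which is why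
dominance of `w` is not asserted here — for a genuine highest weight vector it holds automatically,
but that `sl_2`-argument is not formalised).  Levels `a ↦ a + 7`, rungs `b + 5 ↦ b`.

HONEST FRAMING.  A normal form: it shrinks the search space for a witness of the crux to the
objects of the route's layer-2 programme (`HWVVanishesOnSlice`, `TableauCoordinatesSharpP`) and
makes plethysm / Kadish–Landsberg constraints on `(d; w)` constraints on witnesses.  It does NOT
touch the open content of the crux (Chatterjee–Tengse 2023 §1.3 dir. 2), 8746, 14610 or VP vs
VNP.  No definitions, no named facts.  References: [LandsbergGCT2017] §8;
[KadishLandsberg2014]; [ForbesShpilkaVolk2018] Def. 1; [Burgisser2000] §2.1.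
-/

-- layout Summits/ValiantsHypothesis/ValiantsHypothesis forces the duplicated namespace component
set_option linter.dupNamespace false

noncomputable section

open MvPolynomial

namespace Summit.ValiantsHypothesis.ValiantsHypothesis.Theorems.BarrierLever.IsobaricEquations

open Literature.Computability.AlgebraicComplexity Literature.Barriers.ValiantsHypothesis
open Summit.ValiantsHypothesis.ValiantsHypothesis.Theorems.BarrierLever.SuccinctHittingSetsForVP
open Summit.ValiantsHypothesis.ValiantsHypothesis.Theorems.BarrierLever.BoolSumComponents

/-! ## §10 Torus–unipotent compatibility: torus components of `U`-invariants are `U`-invariant -/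

section torus

variable {n : ℕ}

/-- **Torus conjugation of the unipotent substitution** (`τ ≠ 0`):
`D_τ ∘ u_t = u_{t'} ∘ D_τ` with `t'_ij = t_ij τ^{u_i} τ^{-u_j}`, as substitutions. [folklore] -/
theorem aeval_diag_aeval_unip {τ : ℂ} (hτ : τ ≠ 0) (u : Fin n → ℕ) (t : Fin n → Fin n → ℂ)
    (g : MvPolynomial (Fin n) ℂ) :
    aeval (fun i => C (τ ^ u i) * X i) (aeval (unip t) g) =
      aeval (unip (fun i j => t i j * τ ^ u i * (τ ^ u j)⁻¹)) (aeval (fun i => C (τ ^ u i) * X i) g) := by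
  induction g using MvPolynomial.induction_on with
  | C a => simp only [aeval_C, algebraMap_eq]
  | add p q hp hq => simp only [map_add, hp, hq]
  | mul_X p j hp =>
    have hgen : aeval (fun i => C (τ ^ u i) * X i) (unip t j) =
        aeval (unip (fun i j => t i j * τ ^ u i * (τ ^ u j)⁻¹)) (C (τ ^ u j) * X j : MvPolynomial (Fin n) ℂ) := by
      rw [unip_apply, map_add, aeval_X, map_sum, map_mul, aeval_C, algebraMap_eq, aeval_X, unip_apply,
        mul_add, Finset.mul_sum]
      congr 1
      refine Finset.sum_congr rfl fun i _ => ?_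
      rw [map_mul, aeval_C, algebraMap_eq, aeval_X, ← mul_assoc, ← mul_assoc, ← map_mul,
        ← map_mul]
      congr 2
      have hτj : τ ^ u j ≠ 0 := pow_ne_zero _ hτ
      field_simp
    simp only [map_mul, aeval_X, hp, hgen]

variable [Fintype (degLEMonomials n)]

/-- The coefficient vector scaled by the torus is the coefficient vector of the torus translate:
`f_{τ • c} = τ^{u₀} f_c(τ^{u_i} x_i)`. [folklore] -/
theorem ofCoeffs_torus (τ : ℂ) (u₀ : ℕ) (u : Fin n → ℕ) (c : degLEMonomials n → ℂ) :
    ofCoeffs (fun m => τ ^ (u₀ + ∑ i, u i * (m : Fin n →₀ ℕ) i) * c m) =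
      C (τ ^ u₀) * aeval (fun i => C (τ ^ u i) * X i) (ofCoeffs c) := by
  classical
  refine MvPolynomial.ext _ _ fun m => ?_
  rw [coeff_torusTranslate]
  by_cases hm : m ∈ degLEMonomials n
  · rw [show m = ((⟨m, hm⟩ : degLEMonomials n) : Fin n →₀ ℕ) from rfl, coeff_ofCoeffs, coeff_ofCoeffs]
  · rw [coeff_ofCoeffs_eq_zero _ _ hm, coeff_ofCoeffs_eq_zero _ _ hm, mul_zero]

/-- **Equivariance**: `τ • (T_t c) = T_{t'} (τ • c)` with `t'_ij = t_ij τ^{u_i} τ^{-u_j}` (`τ ≠ 0`), where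
`(τ • c)_m = τ^{u₀ + Σ u_i m_i} c_m`. [folklore] -/
theorem torus_uAct {τ : ℂ} (hτ : τ ≠ 0) (u₀ : ℕ) (u : Fin n → ℕ) (t : Fin n → Fin n → ℂ)
    (c : degLEMonomials n → ℂ) :
    (fun m : degLEMonomials n => τ ^ (u₀ + ∑ i, u i * (m : Fin n →₀ ℕ) i) * uAct t c m) =
      uAct (fun i j => t i j * τ ^ u i * (τ ^ u j)⁻¹)
        (fun m => τ ^ (u₀ + ∑ i, u i * (m : Fin n →₀ ℕ) i) * c m) := by
  funext m
  rw [uAct_apply, uAct_apply, ofCoeffs_torus, map_mul, aeval_C, algebraMap_eq,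
    ← aeval_diag_aeval_unip hτ, coeff_torusTranslate]

/-- **Torus components of a `U`-invariant polynomial are `U`-invariant** (the torus normalises
`U`): for `W m = u₀ + Σ_i u_i m_i` and every `J`,
`E_J(T_t c) = E_J(c)` whenever `E(T_t c) = E(c)` for all `t, c`. [cite: LandsbergGCT2017, §8] -/
theorem eval_uAct_component {E : MvPolynomial (degLEMonomials n) ℂ}
    (hE : ∀ (t : Fin n → Fin n → ℂ) (c : degLEMonomials n → ℂ), eval (uAct t c) E = eval c E)
    (u₀ : ℕ) (u : Fin n → ℕ) (J : ℕ) (t : Fin n → Fin n → ℂ) (c : degLEMonomials n → ℂ) :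
    eval (uAct t c) (weightedHomogeneousComponent
        (fun m : degLEMonomials n => u₀ + ∑ i, u i * (m : Fin n →₀ ℕ) i) J E) =
      eval c (weightedHomogeneousComponent
        (fun m : degLEMonomials n => u₀ + ∑ i, u i * (m : Fin n →₀ ℕ) i) J E) := by
  set W : degLEMonomials n → ℕ := fun m => u₀ + ∑ i, u i * (m : Fin n →₀ ℕ) i with hWdef
  set K := weightedTotalDegree W E with hKdef
  by_cases hJ : J ∈ Finset.range (K + 1)
  · -- the orbit identity, coefficient by coefficient
    have key : ∀ τ : ℂ, τ ≠ 0 → ∑ k ∈ Finset.range (K + 1),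
        τ ^ k * (eval (uAct t c) (weightedHomogeneousComponent W k E) -
          eval c (weightedHomogeneousComponent W k E)) = 0 := by
      intro τ hτ
      simp only [mul_sub, Finset.sum_sub_distrib]
      rw [← Isobaric.eval_torus_eq_sum W (uAct t c) τ E, ← Isobaric.eval_torus_eq_sum W c τ E, sub_eq_zero,
        show (fun m => τ ^ W m * uAct t c m) =
            uAct (fun i j => t i j * τ ^ u i * (τ ^ u j)⁻¹) (fun m => τ ^ W m * c m) from
          torus_uAct hτ u₀ u t c, hE]
    have h := eq_zero_of_sum_pow_mul_eq_zero
      (fun k => eval (uAct t c) (weightedHomogeneousComponent W k E) -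
        eval c (weightedHomogeneousComponent W k E)) K key J hJ
    exact sub_eq_zero.mp h
  · have hJ' : K < J := by rw [Finset.mem_range] at hJ; omega
    rw [weightedHomogeneousComponent_eq_zero J E hJ', map_zero, map_zero]

end torus

/-! ## §11 The torus extraction keeps `U`-invariance -/

section isou

variable {n : ℕ}

/-- **`UEq(n, b+2, a) → UIsoEq(n, b, a+3)` with support tracking** (`n ≥ 64`, `n ≥ 2a + 6`): the
torus-weight extraction of `…Isobaric/WeightVector.lean` (`isoEq_of_eq_support`) applied to a
`U`-invariant witness returns a `U`-invariant torus weight vector (a component for a torus-type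
weight of a `U`-invariant polynomial is `U`-invariant, `eval_uAct_component`). [folklore] -/
theorem isoUEq_of_uEq [Fintype (degLEMonomials n)] {a b : ℕ} (hn : 64 ≤ n) (ha : 2 * a + 6 ≤ n) {q : ℕ}
    (hq : q ≤ (Nat.choose (2 * n) n) ^ a) (H : MvPolynomial (↥(degLEMonomials n) ⊕ Fin q) ℂ)
    (hc : complexity H ≤ (Nat.choose (2 * n) n) ^ a) (hd : H.totalDegree ≤ (Nat.choose (2 * n) n) ^ a)
    (hne : boolSum H ≠ 0)
    (hvan : ∀ f ∈ SmallCircuits ℂ n (b + 2), eval (coeffVector (degLEMonomials n) f) (boolSum H) = 0)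
    (hinv : ∀ (t : Fin n → Fin n → ℂ) (c : degLEMonomials n → ℂ),
      eval (uAct t c) (boolSum H) = eval c (boolSum H)) :
    ∃ q' : ℕ, q' ≤ (Nat.choose (2 * n) n) ^ (a + 3) ∧
      ∃ H' : MvPolynomial (↥(degLEMonomials n) ⊕ Fin q') ℂ,
        complexity H' ≤ (Nat.choose (2 * n) n) ^ (a + 3) ∧
        H'.totalDegree ≤ (Nat.choose (2 * n) n) ^ (a + 3) ∧ boolSum H' ≠ 0 ∧
        (∀ f ∈ SmallCircuits ℂ n b, eval (coeffVector (degLEMonomials n) f) (boolSum H') = 0) ∧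
        (boolSum H').support ⊆ (boolSum H).support ∧
        (∀ (t : Fin n → Fin n → ℂ) (c : degLEMonomials n → ℂ),
          eval (uAct t c) (boolSum H') = eval c (boolSum H')) ∧
        ∃ (d : ℕ) (w : Fin n → ℕ), (boolSum H').IsHomogeneous d ∧
          ∀ i : Fin n, IsWeightedHomogeneous
            (fun m : degLEMonomials n => (m : Fin n →₀ ℕ) i) (boolSum H') (w i) := by
  -- adapted from `isoEq_of_eq_support` (…DefinableEquationsWeightVector.lean), plus `U`-invariance
  classical
  obtain ⟨h5, hnN, -, -⟩ := N_arith hn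
  set N := (2 * n).choose n with hNdef
  set E := boolSum H with hEdef
  set B := n * N ^ a + 1 with hBdef
  set W : degLEMonomials n → ℕ := fun m => B ^ n + ∑ i : Fin n, B ^ (i : ℕ) * (m : Fin n →₀ ℕ) i
    with hWdef
  have hB : 0 < B := Nat.succ_pos _
  have hdegE : E.totalDegree ≤ N ^ a := (totalDegree_boolSum_le H).trans hd
  have hWmax : ∀ m : degLEMonomials n, W m ≤ (n + 1) * B ^ n := by
    intro m
    have hB1 : 1 ≤ B := hB
    have hsum : ∑ i : Fin n, B ^ (i : ℕ) * (m : Fin n →₀ ℕ) i ≤ B ^ n * n := by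
      calc ∑ i : Fin n, B ^ (i : ℕ) * (m : Fin n →₀ ℕ) i
          ≤ ∑ i : Fin n, B ^ n * (m : Fin n →₀ ℕ) i := Finset.sum_le_sum fun i _ =>
            Nat.mul_le_mul_right _ (Nat.pow_le_pow_right hB1 i.2.le)
        _ = B ^ n * ∑ i : Fin n, (m : Fin n →₀ ℕ) i := by rw [Finset.mul_sum]
        _ ≤ B ^ n * n := Nat.mul_le_mul_left _ ?_
      calc ∑ i : Fin n, (m : Fin n →₀ ℕ) i = (m : Fin n →₀ ℕ).degree := by
            rw [Finsupp.degree_apply]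
            exact (Finset.sum_subset (Finset.subset_univ _) fun i _ hi =>
              Finsupp.notMem_support_iff.mp hi).symm
        _ ≤ n := m.2
    calc W m = B ^ n + ∑ i : Fin n, B ^ (i : ℕ) * (m : Fin n →₀ ℕ) i := rfl
      _ ≤ B ^ n + B ^ n * n := Nat.add_le_add_left hsum _
      _ = (n + 1) * B ^ n := by ring
  have hK : weightedTotalDegree W E < 2 ^ N := by
    calc weightedTotalDegree W E ≤ E.totalDegree * ((n + 1) * B ^ n) :=
          weightedTotalDegree_le W _ hWmax E
      _ ≤ N ^ a * ((n + 1) * B ^ n) := Nat.mul_le_mul_right _ hdegE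
      _ < 2 ^ N := wdeg_arith hn ha
  obtain ⟨J, hJmem, hJne⟩ : ∃ J ∈ Finset.range (weightedTotalDegree W E + 1),
      weightedHomogeneousComponent W J E ≠ 0 := by
    by_contra hall
    push Not at hall
    apply hne
    rw [hEdef, ← Isobaric.sum_weightedHomogeneousComponent_range W (boolSum H)
      (weightedTotalDegree W E) (fun d hd => le_weightedTotalDegree W hd)]
    exact Finset.sum_eq_zero hall
  have hJ : J < 2 ^ N := lt_of_le_of_lt (Nat.lt_succ_iff.mp (Finset.mem_range.mp hJmem)) hK
  obtain ⟨H', hsum', hc', hd'⟩ :=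
    exists_boolSum_eq_weightedHomogeneousComponent W H (L := N) (J := J) hK hJ
  obtain ⟨lq, lc, ld⟩ := level_arith (a := a) (q := q) (c := complexity H) (d := H.totalDegree)
    h5 hq hc hd
  have hsupp : (weightedHomogeneousComponent W J E).support ⊆ E.support := by
    intro α hα
    rw [mem_support_iff, coeff_weightedHomogeneousComponent] at hα
    rw [mem_support_iff]
    intro h0; exact hα (by rw [h0, ite_self])
  refine ⟨q + N, lq, H', ?_, hd'.trans ld, ?_, ?_, ?_, ?_, ?_⟩
  · refine hc'.trans ?_
    rw [card_degLEMonomials]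
    exact lc
  · rw [hsum']; exact hJne
  · intro f hf
    rw [hsum']
    exact eval_component_eq_zero (by omega) hvan (B ^ n) (fun i => B ^ (i : ℕ)) J hf
  · rw [hsum']; exact hsupp
  · intro t c
    rw [hsum']
    exact eval_uAct_component hinv (B ^ n) (fun i => B ^ (i : ℕ)) J t c
  · rw [hsum']
    refine weightVector_of_combined hB (weightedHomogeneousComponent_isWeightedHomogeneous J E)
      (fun α hα => ?_) hJne
    have hdegα : α.degree ≤ N ^ a := by
      rw [Finsupp.degree_apply]
      exact (le_totalDegree (hsupp hα)).trans hdegE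
    constructor
    · calc n * α.degree ≤ n * N ^ a := Nat.mul_le_mul_left _ hdegα
        _ < B := Nat.lt_succ_self _
    · calc α.degree ≤ N ^ a := hdegα
        _ ≤ n * N ^ a := Nat.le_mul_of_pos_left _ (by omega)
        _ < B := Nat.lt_succ_self _

end isou

/-! ## §12 The crux and the support item in highest-weight-vector normal form -/

section hwv

variable {n : ℕ}

/-- **Pointwise: `Eq(n, b+5, a) → HWVEq(n, b, a+7)`** (`n ≥ 64`, `n ≥ 2a + 14`): a nonzero
level-`(a+7)` Boolean-sum equation against `SmallCircuits ℂ n b` which is a torus weight vector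
(homogeneous, isobaric for every coordinate grading) AND invariant under the unipotent radical —
a highest weight vector for the Borel subgroup of `GL_n` acting on `ℂ[Sym^{≤ n}(ℂ^n)^*]`.
[cite: LandsbergGCT2017, §8] -/
theorem hwvEq_of_eq {a b : ℕ} (hn : 64 ≤ n) (ha : 2 * a + 14 ≤ n)
    (h : ∃ q : ℕ, q ≤ (Nat.choose (2 * n) n) ^ a ∧
      ∃ H : MvPolynomial (↥(degLEMonomials n) ⊕ Fin q) ℂ,
        complexity H ≤ (Nat.choose (2 * n) n) ^ a ∧ H.totalDegree ≤ (Nat.choose (2 * n) n) ^ a ∧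
        boolSum H ≠ 0 ∧
        ∀ f ∈ SmallCircuits ℂ n (b + 5), eval (coeffVector (degLEMonomials n) f) (boolSum H) = 0) :
    ∃ q : ℕ, q ≤ (Nat.choose (2 * n) n) ^ (a + 7) ∧
      ∃ H : MvPolynomial (↥(degLEMonomials n) ⊕ Fin q) ℂ,
        complexity H ≤ (Nat.choose (2 * n) n) ^ (a + 7) ∧
        H.totalDegree ≤ (Nat.choose (2 * n) n) ^ (a + 7) ∧ boolSum H ≠ 0 ∧
        (∀ f ∈ SmallCircuits ℂ n b, eval (coeffVector (degLEMonomials n) f) (boolSum H) = 0) ∧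
        (∃ (d : ℕ) (w : Fin n → ℕ), (boolSum H).IsHomogeneous d ∧
          ∀ i : Fin n, IsWeightedHomogeneous
            (fun m : degLEMonomials n => (m : Fin n →₀ ℕ) i) (boolSum H) (w i)) ∧
        ∀ (t : Fin n → Fin n → ℂ) (f : MvPolynomial (Fin n) ℂ), f.totalDegree ≤ n →
          eval (coeffVector (degLEMonomials n) (aeval (unip t) f)) (boolSum H) =
            eval (coeffVector (degLEMonomials n) f) (boolSum H) := by
  classical
  haveI : Fintype (degLEMonomials n) := (Finsupp.finite_of_degree_le (σ := Fin n) n).fintype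
  obtain ⟨q, hq, H, hc, hd, hne, hvan, hinv⟩ := uEq_of_eq (a := a) (b := b + 2) hn (by omega) h
  obtain ⟨q', hq', H', hc', hd', hne', hvan', -, hinv', d, w, hhom, hiso⟩ :=
    isoUEq_of_uEq (a := a + 4) (b := b) hn (by omega) hq H hc hd hne hvan hinv
  exact ⟨q', hq', H', hc', hd', hne', hvan', ⟨d, w, hhom, hiso⟩,
    fun t f hf => eval_coeffVector_aeval_unip_of_uAct hinv' t f hf⟩

/-- **`DefinableEquations` in highest-weight-vector normal form.**  The crux holds iff for ONE
level `a` and EVERY `b`, eventually in `n`, some nonzero level-`a` Boolean-sum equation against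
`SmallCircuits ℂ n b` is a torus weight vector (homogeneous of some degree `d`, isobaric of some
weight `w_i` for every coordinate grading `c_m ↦ m_i`) that is invariant under every upper
unitriangular substitution `u_t : x_j ↦ x_j + Σ_{i<j} t_ij x_i` — a HIGHEST WEIGHT VECTOR of weight
`(d; w)` for `GL_n` acting on the polynomial functions on `Sym^{≤ n}(ℂ^n)`.
[cite: LandsbergGCT2017, §8] -/
theorem definableEquations_iff_highestWeightVector :
    Summit.ValiantsHypothesis.ValiantsHypothesis.Theses.BarrierLever.DefinableEquations ↔
      ∃ a : ℕ, ∀ b : ℕ, ∃ n₀ : ℕ, ∀ n ≥ n₀, ∃ q : ℕ, q ≤ (Nat.choose (2 * n) n) ^ a ∧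
        ∃ H : MvPolynomial (↥(degLEMonomials n) ⊕ Fin q) ℂ,
          complexity H ≤ (Nat.choose (2 * n) n) ^ a ∧ H.totalDegree ≤ (Nat.choose (2 * n) n) ^ a ∧
          boolSum H ≠ 0 ∧
          (∀ f ∈ SmallCircuits ℂ n b, eval (coeffVector (degLEMonomials n) f) (boolSum H) = 0) ∧
          (∃ (d : ℕ) (w : Fin n → ℕ), (boolSum H).IsHomogeneous d ∧
            ∀ i : Fin n, IsWeightedHomogeneous
              (fun m : degLEMonomials n => (m : Fin n →₀ ℕ) i) (boolSum H) (w i)) ∧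
          ∀ (t : Fin n → Fin n → ℂ) (f : MvPolynomial (Fin n) ℂ), f.totalDegree ≤ n →
            eval (coeffVector (degLEMonomials n) (aeval (unip t) f)) (boolSum H) =
              eval (coeffVector (degLEMonomials n) f) (boolSum H) := by
  constructor
  · rintro ⟨a, h⟩
    refine ⟨a + 7, fun b => ?_⟩
    obtain ⟨n₁, hn₁⟩ := h (b + 5)
    refine ⟨max n₁ (max 64 (2 * a + 14)), fun n hn => ?_⟩
    exact hwvEq_of_eq (le_trans (le_max_left _ _) ((le_max_right _ _).trans hn))
      (le_trans (le_max_right _ _) ((le_max_right _ _).trans hn)) (hn₁ n ((le_max_left _ _).trans hn))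
  · rintro ⟨a, h⟩
    refine ⟨a, fun b => ?_⟩
    obtain ⟨n₀, hn₀⟩ := h b
    refine ⟨n₀, fun n hn => ?_⟩
    obtain ⟨q, hq, H, hc, hd, hne, hvan, -⟩ := hn₀ n hn
    exact ⟨q, hq, H, hc, hd, hne, hvan⟩

/-- **`SingleSizeEquations` in highest-weight-vector normal form** (the `∀ b ∃ a` item,
stmt-ValiantsHypothesis-8749): equations at rung `b`, if they exist at all, may be taken to be
highest weight vectors (torus weight vectors invariant under the unipotent radical), at the cost of
seven levels. [cite: LandsbergGCT2017, §8] -/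
theorem singleSizeEquations_iff_highestWeightVector :
    Summit.ValiantsHypothesis.ValiantsHypothesis.Theses.BarrierLever.SingleSizeEquations ↔
      ∀ b : ℕ, ∃ a n₀ : ℕ, ∀ n ≥ n₀, ∃ q : ℕ, q ≤ (Nat.choose (2 * n) n) ^ a ∧
        ∃ H : MvPolynomial (↥(degLEMonomials n) ⊕ Fin q) ℂ,
          complexity H ≤ (Nat.choose (2 * n) n) ^ a ∧ H.totalDegree ≤ (Nat.choose (2 * n) n) ^ a ∧
          boolSum H ≠ 0 ∧
          (∀ f ∈ SmallCircuits ℂ n b, eval (coeffVector (degLEMonomials n) f) (boolSum H) = 0) ∧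
          (∃ (d : ℕ) (w : Fin n → ℕ), (boolSum H).IsHomogeneous d ∧
            ∀ i : Fin n, IsWeightedHomogeneous
              (fun m : degLEMonomials n => (m : Fin n →₀ ℕ) i) (boolSum H) (w i)) ∧
          ∀ (t : Fin n → Fin n → ℂ) (f : MvPolynomial (Fin n) ℂ), f.totalDegree ≤ n →
            eval (coeffVector (degLEMonomials n) (aeval (unip t) f)) (boolSum H) =
              eval (coeffVector (degLEMonomials n) f) (boolSum H) := by
  constructor
  · intro h b
    obtain ⟨a, n₁, hn₁⟩ := h (b + 5)
    refine ⟨a + 7, max n₁ (max 64 (2 * a + 14)), fun n hn => ?_⟩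
    exact hwvEq_of_eq (le_trans (le_max_left _ _) ((le_max_right _ _).trans hn))
      (le_trans (le_max_right _ _) ((le_max_right _ _).trans hn)) (hn₁ n ((le_max_left _ _).trans hn))
  · intro h b
    obtain ⟨a, n₀, hn₀⟩ := h b
    refine ⟨a, n₀, fun n hn => ?_⟩
    obtain ⟨q, hq, H, hc, hd, hne, hvan, -⟩ := hn₀ n hn
    exact ⟨q, hq, H, hc, hd, hne, hvan⟩

end hwv

end Summit.ValiantsHypothesis.ValiantsHypothesis.Theorems.BarrierLever.IsobaricEquations

end
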